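import Summits.AtomisticToContinuum.BoseEinsteinCondensation.Theorems.BECCellInformationOneBodyEntropyBoundInsertionAssemblySlices

/-!
# Crux `OneBodyEntropyBound` (stmt-AtomisticToContinuum-13440), line `registered`: stub `stub_insertionAssembly`,
# part 2 — integrated bounds for the dressed product and the position average

Support file (`--supports stmt-AtomisticToContinuum-13440`). For the dressed product
`Ψ(X) = θ(x₀) F(X) Φ(Y)` of part 1 (`…InsertionAssemblySlices`; `F` a Jastrow factor obeying the
directional bounds of `stub_productJastrow`, `Φ` a normalised `n`-body state), this file
integrates the pointwise calculus (Tonelli along `X = (x, Z)`):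
* `lintegral_energyDensity_dressed_le`: given, for every frozen `x`, the first-variation bound of
  `stub_firstVariation` for the sliced factor `Z ↦ F(x, Z)`, the energy of `Ψ` is at most
  `E₀ ‖Ψ‖² + 2∫|∇θ|² + err ∫|θ|² + 9 w`, `w = ∫ |θ(x)|² W₁(x) dx`,
  `W₁(x) = ∫ (Σⱼ (1 − f(x − Z j))) |Φ(Z)|² dZ`;
* `lintegral_normSq_dressed`, `one_le_mass_add`, `mass_le_one`: `‖Ψ‖² = ∫ |θ|² m`,
  `1 ≤ ‖Ψ‖² + 2w`, `‖Ψ‖² ≤ 1`;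
* `insertionAssembly_translate_average`, `lintegral_W₁`: `∫ w(z) dz = ∫ W₁ = n ∫ (1 − f)`.
-/

noncomputable section

namespace Summit.AtomisticToContinuum.BoseEinsteinCondensation.Cruxes.OneBodyEntropyBound.Birth

open MeasureTheory Filter Topology
open scoped ENNReal NNReal
open Literature.MathematicalPhysics.QuantumManyBody.BoseGas

namespace InsertionAssembly

variable {n : ℕ}

/-! ### Tonelli along `X = (x, Z)` and measurability -/

/-- `∫ e(X) dX = ∫ (∫ e(x, Z) dZ) dx`. [folklore] -/
theorem lintegral_eq_lintegral_vecCons {e : Config (n + 1) → ℝ≥0∞} (he : Measurable e) :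
    ∫⁻ X, e X = ∫⁻ x : Space, ∫⁻ Z : Config n, e (Matrix.vecCons x Z) := by
  rw [← (measurePreserving_vecCons (n := n)).lintegral_comp he,
    lintegral_prod (fun p : Space × Config n => e (Matrix.vecCons p.1 p.2))
      (he.comp measurable_vecCons).aemeasurable]

/-- The weight `Σⱼ (1 − f(x − Z j))` is jointly measurable. [folklore] -/
theorem measurable_weight {f : Space → ℝ} (hf : Continuous f) :
    Measurable fun p : Space × Config n => ∑ j : Fin n, ENNReal.ofReal (1 - f (p.1 - p.2 j)) := by
  refine Finset.measurable_sum _ fun j _ => Measurable.ennreal_ofReal ?_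
  exact (continuous_const.sub (hf.comp (continuous_fst.sub
    ((continuous_apply j).comp continuous_snd)))).measurable

/-- `x ↦ W₁(x) = ∫ (Σⱼ (1 − f(x − Z j))) |Φ(Z)|² dZ` is measurable. [folklore] -/
theorem measurable_W₁ {f : Space → ℝ} (hf : Continuous f) {ψ : Config n → ℂ} (hψ : Continuous ψ) :
    Measurable fun x : Space => ∫⁻ Z : Config n,
      (∑ j : Fin n, ENNReal.ofReal (1 - f (x - Z j))) * (‖ψ Z‖₊ : ℝ≥0∞) ^ 2 :=
  ((measurable_weight hf).mul ((measurable_ennnormSq hψ).comp measurable_snd)).lintegral_prod_right'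

/-- `x ↦ m(x) = ∫ F(x, Z)² |Φ(Z)|² dZ` is measurable. [folklore] -/
theorem measurable_mass {F : Config (n + 1) → ℝ} (hF : Continuous F) {ψ : Config n → ℂ}
    (hψ : Continuous ψ) :
    Measurable fun x : Space => ∫⁻ Z : Config n,
      ENNReal.ofReal (F (Matrix.vecCons x Z) ^ 2) * (‖ψ Z‖₊ : ℝ≥0∞) ^ 2 := by
  have h1 : Measurable fun p : Space × Config n => ENNReal.ofReal (F (Matrix.vecCons p.1 p.2) ^ 2) :=
    ((hF.measurable.comp measurable_vecCons).pow_const 2).ennreal_ofReal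
  exact (h1.mul ((measurable_ennnormSq hψ).comp measurable_snd)).lintegral_prod_right'

/-! ### The energy of the dressed product -/

/-- **Inner bound at a frozen `x`.** [folklore] -/
theorem lintegral_energyDensity_dressed_vecCons_le {θz : Space → ℂ} (hθ : ContDiff ℝ 1 θz)
    {F : Config (n + 1) → ℝ} (hF : ContDiff ℝ 1 F) (hF01 : ∀ X, 0 ≤ F X ∧ F X ≤ 1)
    (hF0 : ∀ (X : Config (n + 1)) (w : Space), ‖fderiv ℝ F X (Pi.single 0 w)‖ ≤ (1 - F X) * ‖w‖)
    {f : Space → ℝ} (hf : Continuous f) (hf01 : ∀ z, 0 ≤ f z ∧ f z ≤ 1)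
    (hFsum : ∀ X : Config (n + 1), 1 - F X ≤ ∑ j : Fin n, (1 - f (X 0 - X j.succ)))
    {ψ : Config n → ℂ} (hψ : ContDiff ℝ 1 ψ) (hψ1 : ∫⁻ Z, (‖ψ Z‖₊ : ℝ≥0∞) ^ 2 = 1)
    {v : ℝ → ℝ≥0∞} (hv : Measurable v) (x : Space)
    (hcross : ∀ (Z : Config n) (j : Fin n), v (dist x (Z j)) = 0 ∨ F (Matrix.vecCons x Z) = 0)
    (hG5 : ∀ (Z : Config n) (j : Fin n) (k : Fin 3),
      (fderiv ℝ (fun Z : Config n => F (Matrix.vecCons x Z)) Z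
        (Pi.single j (EuclideanSpace.single k (1 : ℝ)))) ^ 2 ≤ 1 - f (x - Z j))
    {E err : ℝ≥0∞}
    (hJ3 : ∫⁻ Z, (kineticDensity (fun Z : Config n => (F (Matrix.vecCons x Z) : ℂ) * ψ Z) Z +
        interaction v Z * (‖(F (Matrix.vecCons x Z) : ℂ) * ψ Z‖₊ : ℝ≥0∞) ^ 2) ≤
      E * (∫⁻ Z, ENNReal.ofReal (F (Matrix.vecCons x Z) ^ 2) * (‖ψ Z‖₊ : ℝ≥0∞) ^ 2) +
        (∫⁻ Z, (∑ j : Fin n, ∑ k : Fin 3, ENNReal.ofReal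
          ((fderiv ℝ (fun Z : Config n => F (Matrix.vecCons x Z)) Z
            (Pi.single j (EuclideanSpace.single k (1 : ℝ)))) ^ 2)) * (‖ψ Z‖₊ : ℝ≥0∞) ^ 2) + err) :
    ∫⁻ Z : Config n,
        (kineticDensity (fun X : Config (n + 1) => θz (X 0) * ((F X : ℂ) * ψ (fun j => X j.succ)))
            (Matrix.vecCons x Z) +
          interaction v (Matrix.vecCons x Z) *
            (‖(fun X : Config (n + 1) => θz (X 0) * ((F X : ℂ) * ψ (fun j => X j.succ)))
              (Matrix.vecCons x Z)‖₊ : ℝ≥0∞) ^ 2) ≤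
      2 * gradSqC θz x +
        (‖θz x‖₊ : ℝ≥0∞) ^ 2 *
          (E * ∫⁻ Z, ENNReal.ofReal (F (Matrix.vecCons x Z) ^ 2) * (‖ψ Z‖₊ : ℝ≥0∞) ^ 2) +
        9 * ((‖θz x‖₊ : ℝ≥0∞) ^ 2 *
          ∫⁻ Z, (∑ j : Fin n, ENNReal.ofReal (1 - f (x - Z j))) * (‖ψ Z‖₊ : ℝ≥0∞) ^ 2) +
        (‖θz x‖₊ : ℝ≥0∞) ^ 2 * err := by
  have hθd := hθ.differentiable one_ne_zero
  have hFd := hF.differentiable one_ne_zero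
  have hψd := hψ.differentiable one_ne_zero
  -- measurability
  have hmn : Measurable fun Z : Config n => (‖ψ Z‖₊ : ℝ≥0∞) ^ 2 := measurable_ennnormSq hψ.continuous
  have hmS : Measurable fun Z : Config n => ∑ j : Fin n, ENNReal.ofReal (1 - f (x - Z j)) := by
    refine Finset.measurable_sum _ fun j _ => Measurable.ennreal_ofReal ?_
    exact (continuous_const.sub (hf.comp (continuous_const.sub (continuous_apply j)))).measurable
  have hmSn : Measurable fun Z : Config n =>
      (∑ j : Fin n, ENNReal.ofReal (1 - f (x - Z j))) * (‖ψ Z‖₊ : ℝ≥0∞) ^ 2 := hmS.mul hmn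
  have hslice : Continuous fun Z : Config n => (F (Matrix.vecCons x Z) : ℂ) * ψ Z :=
    (Complex.continuous_ofReal.comp (hF.continuous.comp
      (continuous_const.matrixVecCons continuous_id))).mul hψ.continuous
  have hme : Measurable fun Z : Config n =>
      kineticDensity (fun Z : Config n => (F (Matrix.vecCons x Z) : ℂ) * ψ Z) Z +
        interaction v Z * (‖(F (Matrix.vecCons x Z) : ℂ) * ψ Z‖₊ : ℝ≥0∞) ^ 2 :=
    measurable_energyDensity hv hslice
  -- the gradient-weight term of the first variation is at most `3 W₁`
  have hW₃ : (∫⁻ Z, (∑ j : Fin n, ∑ k : Fin 3, ENNReal.ofReal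
      ((fderiv ℝ (fun Z : Config n => F (Matrix.vecCons x Z)) Z
        (Pi.single j (EuclideanSpace.single k (1 : ℝ)))) ^ 2)) * (‖ψ Z‖₊ : ℝ≥0∞) ^ 2) ≤
      3 * ∫⁻ Z, (∑ j : Fin n, ENNReal.ofReal (1 - f (x - Z j))) * (‖ψ Z‖₊ : ℝ≥0∞) ^ 2 := by
    rw [← lintegral_const_mul _ hmSn]
    refine lintegral_mono fun Z => ?_
    rw [← mul_assoc, Finset.mul_sum]
    refine mul_le_mul' (Finset.sum_le_sum fun j _ => ?_) le_rfl
    calc ∑ k : Fin 3, ENNReal.ofReal ((fderiv ℝ (fun Z : Config n => F (Matrix.vecCons x Z)) Z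
          (Pi.single j (EuclideanSpace.single k (1 : ℝ)))) ^ 2)
        ≤ ∑ _k : Fin 3, ENNReal.ofReal (1 - f (x - Z j)) :=
          Finset.sum_le_sum fun k _ => ENNReal.ofReal_le_ofReal (hG5 Z j k)
      _ = 3 * ENNReal.ofReal (1 - f (x - Z j)) := by simp
  -- pointwise
  have hpt : ∀ Z : Config n,
      kineticDensity (fun X : Config (n + 1) => θz (X 0) * ((F X : ℂ) * ψ (fun j => X j.succ)))
            (Matrix.vecCons x Z) +
          interaction v (Matrix.vecCons x Z) *
            (‖(fun X : Config (n + 1) => θz (X 0) * ((F X : ℂ) * ψ (fun j => X j.succ)))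
              (Matrix.vecCons x Z)‖₊ : ℝ≥0∞) ^ 2 ≤
        (2 * gradSqC θz x * (‖ψ Z‖₊ : ℝ≥0∞) ^ 2 +
          6 * ((‖θz x‖₊ : ℝ≥0∞) ^ 2 *
            ((∑ j : Fin n, ENNReal.ofReal (1 - f (x - Z j))) * (‖ψ Z‖₊ : ℝ≥0∞) ^ 2))) +
        (‖θz x‖₊ : ℝ≥0∞) ^ 2 *
          (kineticDensity (fun Z : Config n => (F (Matrix.vecCons x Z) : ℂ) * ψ Z) Z +
            interaction v Z * (‖(F (Matrix.vecCons x Z) : ℂ) * ψ Z‖₊ : ℝ≥0∞) ^ 2) := by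
    intro Z
    rw [energyDensity_dressed_vecCons hθd hFd hψd v x Z (hcross Z)]
    refine add_le_add ?_ le_rfl
    have h := partialGradSq_dressed_le hθd hFd hF01 hF0 hf01 hFsum hψd (Matrix.vecCons x Z)
    simp only [Matrix.cons_val_zero, Matrix.cons_val_succ] at h
    exact h
  have hmA : Measurable fun Z : Config n => 2 * gradSqC θz x * (‖ψ Z‖₊ : ℝ≥0∞) ^ 2 +
      6 * ((‖θz x‖₊ : ℝ≥0∞) ^ 2 *
        ((∑ j : Fin n, ENNReal.ofReal (1 - f (x - Z j))) * (‖ψ Z‖₊ : ℝ≥0∞) ^ 2)) :=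
    (hmn.const_mul _).add ((hmSn.const_mul _).const_mul _)
  refine (lintegral_mono hpt).trans ?_
  rw [lintegral_add_left hmA, lintegral_add_left (hmn.const_mul _), lintegral_const_mul _ hmn,
    lintegral_const_mul _ (hmSn.const_mul _), lintegral_const_mul _ hmSn,
    lintegral_const_mul _ hme, hψ1, mul_one]
  calc 2 * gradSqC θz x + 6 * ((‖θz x‖₊ : ℝ≥0∞) ^ 2 *
          ∫⁻ Z, (∑ j : Fin n, ENNReal.ofReal (1 - f (x - Z j))) * (‖ψ Z‖₊ : ℝ≥0∞) ^ 2) +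
        (‖θz x‖₊ : ℝ≥0∞) ^ 2 *
          ∫⁻ Z, (kineticDensity (fun Z : Config n => (F (Matrix.vecCons x Z) : ℂ) * ψ Z) Z +
            interaction v Z * (‖(F (Matrix.vecCons x Z) : ℂ) * ψ Z‖₊ : ℝ≥0∞) ^ 2)
      ≤ 2 * gradSqC θz x + 6 * ((‖θz x‖₊ : ℝ≥0∞) ^ 2 *
          ∫⁻ Z, (∑ j : Fin n, ENNReal.ofReal (1 - f (x - Z j))) * (‖ψ Z‖₊ : ℝ≥0∞) ^ 2) +
        (‖θz x‖₊ : ℝ≥0∞) ^ 2 *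
          (E * (∫⁻ Z, ENNReal.ofReal (F (Matrix.vecCons x Z) ^ 2) * (‖ψ Z‖₊ : ℝ≥0∞) ^ 2) +
            3 * (∫⁻ Z, (∑ j : Fin n, ENNReal.ofReal (1 - f (x - Z j))) * (‖ψ Z‖₊ : ℝ≥0∞) ^ 2) +
            err) :=
        add_le_add le_rfl (mul_le_mul' le_rfl (hJ3.trans (add_le_add_three le_rfl hW₃ le_rfl)))
    _ = _ := by ring

/-- **The energy of the dressed product.** Integrating the inner bound over the position of the
inserted particle: `𝓔[Ψ] ≤ E ∫|θ|²m + (2∫|∇θ|² + err ∫|θ|²) + 9 ∫|θ|² W₁`. [folklore] -/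
theorem lintegral_energyDensity_dressed_le {θz : Space → ℂ} (hθ : ContDiff ℝ 1 θz)
    {F : Config (n + 1) → ℝ} (hF : ContDiff ℝ 1 F) (hF01 : ∀ X, 0 ≤ F X ∧ F X ≤ 1)
    (hF0 : ∀ (X : Config (n + 1)) (w : Space), ‖fderiv ℝ F X (Pi.single 0 w)‖ ≤ (1 - F X) * ‖w‖)
    {f : Space → ℝ} (hf : Continuous f) (hf01 : ∀ z, 0 ≤ f z ∧ f z ≤ 1)
    (hFsum : ∀ X : Config (n + 1), 1 - F X ≤ ∑ j : Fin n, (1 - f (X 0 - X j.succ)))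
    {ψ : Config n → ℂ} (hψ : ContDiff ℝ 1 ψ) (hψ1 : ∫⁻ Z, (‖ψ Z‖₊ : ℝ≥0∞) ^ 2 = 1)
    {v : ℝ → ℝ≥0∞} (hv : Measurable v)
    (hcross : ∀ (x : Space) (Z : Config n) (j : Fin n),
      v (dist x (Z j)) = 0 ∨ F (Matrix.vecCons x Z) = 0)
    (hG5 : ∀ (x : Space) (Z : Config n) (j : Fin n) (k : Fin 3),
      (fderiv ℝ (fun Z : Config n => F (Matrix.vecCons x Z)) Z
        (Pi.single j (EuclideanSpace.single k (1 : ℝ)))) ^ 2 ≤ 1 - f (x - Z j))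
    {E err : ℝ≥0∞}
    (hJ3 : ∀ x : Space,
      ∫⁻ Z, (kineticDensity (fun Z : Config n => (F (Matrix.vecCons x Z) : ℂ) * ψ Z) Z +
        interaction v Z * (‖(F (Matrix.vecCons x Z) : ℂ) * ψ Z‖₊ : ℝ≥0∞) ^ 2) ≤
      E * (∫⁻ Z, ENNReal.ofReal (F (Matrix.vecCons x Z) ^ 2) * (‖ψ Z‖₊ : ℝ≥0∞) ^ 2) +
        (∫⁻ Z, (∑ j : Fin n, ∑ k : Fin 3, ENNReal.ofReal
          ((fderiv ℝ (fun Z : Config n => F (Matrix.vecCons x Z)) Z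
            (Pi.single j (EuclideanSpace.single k (1 : ℝ)))) ^ 2)) * (‖ψ Z‖₊ : ℝ≥0∞) ^ 2) + err) :
    ∫⁻ X, (kineticDensity (fun X : Config (n + 1) => θz (X 0) * ((F X : ℂ) * ψ (fun j => X j.succ))) X +
        interaction v X *
          (‖(fun X : Config (n + 1) => θz (X 0) * ((F X : ℂ) * ψ (fun j => X j.succ))) X‖₊ :
            ℝ≥0∞) ^ 2) ≤
      E * (∫⁻ x, (‖θz x‖₊ : ℝ≥0∞) ^ 2 *
          ∫⁻ Z, ENNReal.ofReal (F (Matrix.vecCons x Z) ^ 2) * (‖ψ Z‖₊ : ℝ≥0∞) ^ 2) +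
        (2 * (∫⁻ x, gradSqC θz x) + err * ∫⁻ x, (‖θz x‖₊ : ℝ≥0∞) ^ 2) +
        9 * ∫⁻ x, (‖θz x‖₊ : ℝ≥0∞) ^ 2 *
          ∫⁻ Z, (∑ j : Fin n, ENNReal.ofReal (1 - f (x - Z j))) * (‖ψ Z‖₊ : ℝ≥0∞) ^ 2 := by
  have hme : Measurable fun X : Config (n + 1) =>
      kineticDensity (fun X : Config (n + 1) => θz (X 0) * ((F X : ℂ) * ψ (fun j => X j.succ))) X +
        interaction v X *
          (‖(fun X : Config (n + 1) => θz (X 0) * ((F X : ℂ) * ψ (fun j => X j.succ))) X‖₊ :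
            ℝ≥0∞) ^ 2 :=
    measurable_energyDensity hv (contDiff_dressed hθ hF hψ).continuous
  have hmt : Measurable fun x : Space => (‖θz x‖₊ : ℝ≥0∞) ^ 2 :=
    (hθ.continuous.measurable.nnnorm.coe_nnreal_ennreal).pow_const 2
  have hmg : Measurable (gradSqC θz) := measurable_gradSqC_any θz
  have hmm := measurable_mass (n := n) hF.continuous hψ.continuous
  have hmW := measurable_W₁ (n := n) hf hψ.continuous
  have hmtm : Measurable fun x : Space => (‖θz x‖₊ : ℝ≥0∞) ^ 2 *
      ∫⁻ Z, ENNReal.ofReal (F (Matrix.vecCons x Z) ^ 2) * (‖ψ Z‖₊ : ℝ≥0∞) ^ 2 := hmt.mul hmm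
  have hmtW : Measurable fun x : Space => (‖θz x‖₊ : ℝ≥0∞) ^ 2 *
      ∫⁻ Z, (∑ j : Fin n, ENNReal.ofReal (1 - f (x - Z j))) * (‖ψ Z‖₊ : ℝ≥0∞) ^ 2 := hmt.mul hmW
  rw [lintegral_eq_lintegral_vecCons hme]
  refine (lintegral_mono fun x => lintegral_energyDensity_dressed_vecCons_le hθ hF hF01 hF0 hf hf01
    hFsum hψ hψ1 hv x (hcross x) (hG5 x) (hJ3 x)).trans (le_of_eq ?_)
  rw [lintegral_add_right _ (hmt.mul_const _), lintegral_add_right _ (hmtW.const_mul _),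
    lintegral_add_left (hmg.const_mul _), lintegral_const_mul _ hmg, lintegral_mul_const _ hmt,
    lintegral_const_mul _ hmtW]
  have : ∫⁻ x, (‖θz x‖₊ : ℝ≥0∞) ^ 2 *
      (E * ∫⁻ Z, ENNReal.ofReal (F (Matrix.vecCons x Z) ^ 2) * (‖ψ Z‖₊ : ℝ≥0∞) ^ 2) =
      E * ∫⁻ x, (‖θz x‖₊ : ℝ≥0∞) ^ 2 *
        ∫⁻ Z, ENNReal.ofReal (F (Matrix.vecCons x Z) ^ 2) * (‖ψ Z‖₊ : ℝ≥0∞) ^ 2 := by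
    rw [← lintegral_const_mul _ hmtm]
    exact lintegral_congr fun x => by ring
  rw [this]
  ring

/-- **The norm of the dressed product**: `‖Ψ‖² = ∫ |θ(x)|² (∫ F(x,Z)² |Φ(Z)|² dZ) dx`. [folklore] -/
theorem lintegral_normSq_dressed {θz : Space → ℂ} (hθ : Continuous θz) {F : Config (n + 1) → ℝ}
    (hF : Continuous F) {ψ : Config n → ℂ} (hψ : Continuous ψ) :
    ∫⁻ X, (‖(fun X : Config (n + 1) => θz (X 0) * ((F X : ℂ) * ψ (fun j => X j.succ))) X‖₊ :
        ℝ≥0∞) ^ 2 =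
      ∫⁻ x, (‖θz x‖₊ : ℝ≥0∞) ^ 2 *
        ∫⁻ Z, ENNReal.ofReal (F (Matrix.vecCons x Z) ^ 2) * (‖ψ Z‖₊ : ℝ≥0∞) ^ 2 := by
  have hc : Continuous fun X : Config (n + 1) => θz (X 0) * ((F X : ℂ) * ψ (fun j => X j.succ)) :=
    (hθ.comp (continuous_apply 0)).mul ((Complex.continuous_ofReal.comp hF).mul
      (hψ.comp (continuous_pi fun j => continuous_apply j.succ)))
  have hm1 : ∀ x : Space, Measurable fun Z : Config n =>
      ENNReal.ofReal (F (Matrix.vecCons x Z) ^ 2) * (‖ψ Z‖₊ : ℝ≥0∞) ^ 2 := fun x =>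
    (((hF.measurable.comp (continuous_const.matrixVecCons continuous_id).measurable).pow_const
      2).ennreal_ofReal).mul (measurable_ennnormSq hψ)
  rw [lintegral_eq_lintegral_vecCons (measurable_ennnormSq hc)]
  refine lintegral_congr fun x => ?_
  rw [← lintegral_const_mul _ (hm1 x)]
  refine lintegral_congr fun Z => ?_
  simp only [Matrix.cons_val_zero, Matrix.cons_val_succ]
  rw [ennnorm_mul_sq, DenseCell.ennnorm_real_mul_sq]

/-- **Mass lower bound**: `1 ≤ ‖Ψ‖² + 2w`, from `1 ≤ F² + 2(1 − F) ≤ F² + 2Σⱼ(1 − fⱼ)` pointwise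
and `∫|θ|² = ∫|Φ|² = 1`. [folklore] -/
theorem one_le_mass_add {θz : Space → ℂ} (hθ : Continuous θz)
    (hθ1 : ∫⁻ x, (‖θz x‖₊ : ℝ≥0∞) ^ 2 = 1) {F : Config (n + 1) → ℝ} (hF : Continuous F)
    (hF01 : ∀ X, 0 ≤ F X ∧ F X ≤ 1) {f : Space → ℝ} (hf : Continuous f)
    (hf01 : ∀ z, 0 ≤ f z ∧ f z ≤ 1)
    (hFsum : ∀ X : Config (n + 1), 1 - F X ≤ ∑ j : Fin n, (1 - f (X 0 - X j.succ)))
    {ψ : Config n → ℂ} (hψ : Continuous ψ) (hψ1 : ∫⁻ Z, (‖ψ Z‖₊ : ℝ≥0∞) ^ 2 = 1) :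
    1 ≤ (∫⁻ x, (‖θz x‖₊ : ℝ≥0∞) ^ 2 *
          ∫⁻ Z, ENNReal.ofReal (F (Matrix.vecCons x Z) ^ 2) * (‖ψ Z‖₊ : ℝ≥0∞) ^ 2) +
        2 * ∫⁻ x, (‖θz x‖₊ : ℝ≥0∞) ^ 2 *
          ∫⁻ Z, (∑ j : Fin n, ENNReal.ofReal (1 - f (x - Z j))) * (‖ψ Z‖₊ : ℝ≥0∞) ^ 2 := by
  have hmt : Measurable fun x : Space => (‖θz x‖₊ : ℝ≥0∞) ^ 2 :=
    (hθ.measurable.nnnorm.coe_nnreal_ennreal).pow_const 2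
  have hmn : Measurable fun Z : Config n => (‖ψ Z‖₊ : ℝ≥0∞) ^ 2 := measurable_ennnormSq hψ
  have hmm := measurable_mass (n := n) hF hψ
  have hmW := measurable_W₁ (n := n) hf hψ
  have hm1 : ∀ x : Space, Measurable fun Z : Config n =>
      ENNReal.ofReal (F (Matrix.vecCons x Z) ^ 2) * (‖ψ Z‖₊ : ℝ≥0∞) ^ 2 := fun x =>
    (((hF.measurable.comp (continuous_const.matrixVecCons continuous_id).measurable).pow_const
      2).ennreal_ofReal).mul hmn
  -- pointwise: `1 ≤ F² + 2 Σⱼ (1 − fⱼ)`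
  have hpt : ∀ (x : Space) (Z : Config n), (‖ψ Z‖₊ : ℝ≥0∞) ^ 2 ≤
      ENNReal.ofReal (F (Matrix.vecCons x Z) ^ 2) * (‖ψ Z‖₊ : ℝ≥0∞) ^ 2 +
        2 * ((∑ j : Fin n, ENNReal.ofReal (1 - f (x - Z j))) * (‖ψ Z‖₊ : ℝ≥0∞) ^ 2) := by
    intro x Z
    rw [← mul_assoc, ← add_mul]
    refine le_mul_of_one_le_left' ?_
    have hs := hFsum (Matrix.vecCons x Z)
    simp only [Matrix.cons_val_zero, Matrix.cons_val_succ] at hs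
    have h0 := (hF01 (Matrix.vecCons x Z)).1
    have h1 := (hF01 (Matrix.vecCons x Z)).2
    have hs0 : 0 ≤ ∑ j : Fin n, (1 - f (x - Z j)) :=
      Finset.sum_nonneg fun j _ => by linarith [(hf01 (x - Z j)).2]
    rw [← ENNReal.ofReal_sum_of_nonneg (fun j _ => by linarith [(hf01 (x - Z j)).2])]
    calc (1 : ℝ≥0∞) = ENNReal.ofReal 1 := ENNReal.ofReal_one.symm
      _ ≤ ENNReal.ofReal (F (Matrix.vecCons x Z) ^ 2 + 2 * ∑ j : Fin n, (1 - f (x - Z j))) :=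
          ENNReal.ofReal_le_ofReal (by nlinarith)
      _ = _ := by
          rw [ENNReal.ofReal_add (sq_nonneg _) (by positivity), ENNReal.ofReal_mul (by norm_num),
            ENNReal.ofReal_ofNat]
  have hmSn : ∀ x : Space, Measurable fun Z : Config n =>
      (∑ j : Fin n, ENNReal.ofReal (1 - f (x - Z j))) * (‖ψ Z‖₊ : ℝ≥0∞) ^ 2 := by
    intro x
    refine Measurable.mul (Finset.measurable_sum _ fun j _ => Measurable.ennreal_ofReal ?_) hmn
    exact (continuous_const.sub (hf.comp (continuous_const.sub (continuous_apply j)))).measurable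
  have hmtm : Measurable fun x : Space => (‖θz x‖₊ : ℝ≥0∞) ^ 2 *
      ∫⁻ Z, ENNReal.ofReal (F (Matrix.vecCons x Z) ^ 2) * (‖ψ Z‖₊ : ℝ≥0∞) ^ 2 := hmt.mul hmm
  have hmtW : Measurable fun x : Space => (‖θz x‖₊ : ℝ≥0∞) ^ 2 *
      ∫⁻ Z, (∑ j : Fin n, ENNReal.ofReal (1 - f (x - Z j))) * (‖ψ Z‖₊ : ℝ≥0∞) ^ 2 := hmt.mul hmW
  calc (1 : ℝ≥0∞) = ∫⁻ x, (‖θz x‖₊ : ℝ≥0∞) ^ 2 * ∫⁻ Z, (‖ψ Z‖₊ : ℝ≥0∞) ^ 2 := by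
        rw [hψ1]; simp [hθ1]
    _ ≤ ∫⁻ x, (‖θz x‖₊ : ℝ≥0∞) ^ 2 *
          ((∫⁻ Z, ENNReal.ofReal (F (Matrix.vecCons x Z) ^ 2) * (‖ψ Z‖₊ : ℝ≥0∞) ^ 2) +
            2 * ∫⁻ Z, (∑ j : Fin n, ENNReal.ofReal (1 - f (x - Z j))) *
              (‖ψ Z‖₊ : ℝ≥0∞) ^ 2) := by
        refine lintegral_mono fun x => mul_le_mul' le_rfl ?_
        rw [← lintegral_const_mul _ (hmSn x), ← lintegral_add_left (hm1 x)]
        exact lintegral_mono (hpt x)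
    _ = _ := by
        rw [← lintegral_const_mul _ hmtW, ← lintegral_add_left hmtm]
        exact lintegral_congr fun x => by ring

/-- **Mass upper bound**: `‖Ψ‖² ≤ 1` (`F² ≤ 1`, `∫|θ|² = ∫|Φ|² = 1`). [folklore] -/
theorem mass_le_one {θz : Space → ℂ} (hθ1 : ∫⁻ x, (‖θz x‖₊ : ℝ≥0∞) ^ 2 = 1)
    {F : Config (n + 1) → ℝ} (hF01 : ∀ X, 0 ≤ F X ∧ F X ≤ 1)
    {ψ : Config n → ℂ} (hψ1 : ∫⁻ Z, (‖ψ Z‖₊ : ℝ≥0∞) ^ 2 = 1) :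
    (∫⁻ x, (‖θz x‖₊ : ℝ≥0∞) ^ 2 *
        ∫⁻ Z, ENNReal.ofReal (F (Matrix.vecCons x Z) ^ 2) * (‖ψ Z‖₊ : ℝ≥0∞) ^ 2) ≤ 1 := by
  calc _ ≤ ∫⁻ x, (‖θz x‖₊ : ℝ≥0∞) ^ 2 * 1 := by
        refine lintegral_mono fun x => mul_le_mul' le_rfl ?_
        rw [← hψ1]
        refine lintegral_mono fun Z => mul_le_of_le_one_left' ?_
        rw [← ENNReal.ofReal_one]
        refine ENNReal.ofReal_le_ofReal ?_
        have h0 := (hF01 (Matrix.vecCons x Z)).1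
        have h1 := (hF01 (Matrix.vecCons x Z)).2
        nlinarith
    _ = 1 := by simp [hθ1]

end InsertionAssembly

/-- **Averaging the position of the inserted particle**: `∫ (∫ |θ(x − z)|² W(x) dx) dz = ∫ W`
for `∫|θ|² = 1` (Tonelli; Lebesgue measure is translation and reflection invariant; registered
helper stub of `stub_insertionAssembly`, part 2). [folklore] -/
theorem insertionAssembly_translate_average :
    ∀ {θ : Literature.MathematicalPhysics.QuantumManyBody.BoseGas.Space → ℂ}, Continuous θ →
      (∫⁻ x, (‖θ x‖₊ : ENNReal) ^ 2) = 1 →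
      ∀ {W : Literature.MathematicalPhysics.QuantumManyBody.BoseGas.Space → ENNReal}, Measurable W →
        (∫⁻ z : Literature.MathematicalPhysics.QuantumManyBody.BoseGas.Space,
          ∫⁻ x : Literature.MathematicalPhysics.QuantumManyBody.BoseGas.Space,
            (‖θ (x - z)‖₊ : ENNReal) ^ 2 * W x) = ∫⁻ x, W x := by
  intro θ hθ hθ1 W hW
  have hm : Measurable (Function.uncurry fun (z x : Space) => (‖θ (x - z)‖₊ : ℝ≥0∞) ^ 2 * W x) :=
    (((hθ.comp (continuous_snd.sub continuous_fst)).measurable.nnnorm.coe_nnreal_ennreal).pow_const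
      2).mul (hW.comp measurable_snd)
  rw [lintegral_lintegral_swap hm.aemeasurable]
  refine lintegral_congr fun x => ?_
  have hmx : Measurable fun z : Space => (‖θ (x - z)‖₊ : ℝ≥0∞) ^ 2 :=
    ((hθ.comp (continuous_const.sub continuous_id)).measurable.nnnorm.coe_nnreal_ennreal).pow_const 2
  rw [lintegral_mul_const _ hmx]
  have h := lintegral_sub_left_eq_self (μ := (volume : Measure Space))
    (fun y : Space => (‖θ y‖₊ : ℝ≥0∞) ^ 2) x
  rw [hθ1] at h
  rw [h, one_mul]

namespace InsertionAssembly

variable {n : ℕ}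

/-- The position average is a measurable function of the position. [folklore] -/
theorem measurable_lintegral_translate_mul {θ : Space → ℂ} (hθ : Continuous θ) {W : Space → ℝ≥0∞}
    (hW : Measurable W) :
    Measurable fun z : Space => ∫⁻ x : Space, (‖θ (x - z)‖₊ : ℝ≥0∞) ^ 2 * W x :=
  ((((hθ.comp (continuous_snd.sub continuous_fst)).measurable.nnnorm.coe_nnreal_ennreal).pow_const
      2).mul (hW.comp measurable_snd)).lintegral_prod_right'

/-- **The integrated weight**: `∫ W₁ = n ∫ (1 − f)` (Tonelli, translation invariance, `∫|Φ|² = 1`).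
[folklore] -/
theorem lintegral_W₁ {f : Space → ℝ} (hf : Continuous f) {ψ : Config n → ℂ} (hψ : Continuous ψ)
    (hψ1 : ∫⁻ Z, (‖ψ Z‖₊ : ℝ≥0∞) ^ 2 = 1) :
    ∫⁻ x : Space, ∫⁻ Z : Config n,
        (∑ j : Fin n, ENNReal.ofReal (1 - f (x - Z j))) * (‖ψ Z‖₊ : ℝ≥0∞) ^ 2 =
      n * ∫⁻ y : Space, ENNReal.ofReal (1 - f y) := by
  have hm := (measurable_weight (n := n) hf).mul ((measurable_ennnormSq hψ).comp measurable_snd)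
  rw [lintegral_lintegral_swap hm.aemeasurable]
  have hinner : ∀ Z : Config n,
      ∫⁻ x : Space, (∑ j : Fin n, ENNReal.ofReal (1 - f (x - Z j))) * (‖ψ Z‖₊ : ℝ≥0∞) ^ 2 =
        (n * ∫⁻ y : Space, ENNReal.ofReal (1 - f y)) * (‖ψ Z‖₊ : ℝ≥0∞) ^ 2 := by
    intro Z
    have hmj : ∀ j : Fin n, Measurable fun x : Space => ENNReal.ofReal (1 - f (x - Z j)) := fun j =>
      (continuous_const.sub (hf.comp (continuous_id.sub continuous_const))).measurable.ennreal_ofReal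
    rw [lintegral_mul_const _ (Finset.measurable_sum _ fun j _ => hmj j),
      lintegral_finsetSum _ fun j _ => hmj j]
    have : ∀ j : Fin n, ∫⁻ x : Space, ENNReal.ofReal (1 - f (x - Z j)) =
        ∫⁻ y : Space, ENNReal.ofReal (1 - f y) := fun j =>
      lintegral_sub_right_eq_self (μ := (volume : Measure Space))
        (fun y : Space => ENNReal.ofReal (1 - f y)) (Z j)
    simp only [this, Finset.sum_const, Finset.card_univ, Fintype.card_fin, nsmul_eq_mul]
  simp_rw [hinner]
  rw [lintegral_const_mul _ (measurable_ennnormSq hψ), hψ1, mul_one]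

end InsertionAssembly

end Summit.AtomisticToContinuum.BoseEinsteinCondensation.Cruxes.OneBodyEntropyBound.Birth

end
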